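import Summits.HodgeConjecture.HodgeConjecture.Theses.BoundaryReadout
import Summits.HodgeConjecture.HodgeConjecture.Theses.LinearSystemTorelli
import Summits.HodgeConjecture.HodgeConjecture.Theorems.BoundaryReadoutAbsoluteReductionStubAbsoluteOfIso
import Summits.HodgeConjecture.HodgeConjecture.Theorems.QbarEnvelopeEnvelopeStubNumberFieldModel
import Summits.HodgeConjecture.HodgeConjecture.Theorems.LinearSystemTorelliMiddleDivisorSupportFourfoldStubFiniteMonodromyOfTypeStability
import Literature.AlgebraicGeometry.HodgeTheory.ContinuationLoopsZariskiOpen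
import Literature.AlgebraicGeometry.HodgeTheory.HodgeGenericQbarDescentFiniteMonodromyInputs
import Literature.AlgebraicGeometry.HodgeTheory.IsoTransport
import Literature.Barriers.HodgeConjecture.ConjugateVarietiesProofs
import HarnessLib

/-!
# Route `BoundaryReadout` — crux `AbsoluteReduction` (stmt-HodgeConjecture-15945):
# the crux modulo an ÉTALE `ℚ̄`-NEIGHBOURHOOD TRIVIALISING THE MONODROMY OF AN ABSOLUTE CLASS

Conditional file for the crux item stmt-HodgeConjecture-15945 (`--workitem`; it closes nothing by
itself). It records a SECOND road to the crux, shorter than the registered line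
`Cruxes/AbsoluteReduction/Lines/generic_flatness.lean` (composed in
`Theorems/BoundaryReadoutAbsoluteReductionOfTypeStability.lean`, crux ⟸ S2 ∧ Riemann existence ∧
partie fixe ∧ pull-back): Riemann's existence theorem (the `ℚ̄`-descent of the finite covering
attached to the finite monodromy orbit) and the whole detour "type stability outside `Z₀` ⇒ loop
shrinking ⇒ finite orbit" are NOT needed for ABSOLUTE classes, because the printed proof
(Charles–Schnell 2014, Thm. 11.3.15 (1) with Cor. 11.3.16 = arXiv:1101.3647 Thm. 44 (1) and Thm. 45;
Voisin 2007 §3, first paragraph of the proof of Prop. 1.2) produces the étale neighbourhood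
DIRECTLY from the field of definition of the class: at a `ℚ̄`-generic point `s` an absolute class
`α` on `𝒳_s` is an algebraic de Rham class defined over a finite extension `K'` of the function field
`ℚ̄(S₀)` (Cor. 11.3.16 with `k` = the algebraic closure of `ℚ̄(S₀)` in `ℂ`); spreading `K'` gives an
étale `g₀ : S₀' ⟶ S₀` over `ℚ̄` with `S₀'` integral quasi-projective and a complex point `s'` over
`s`; the algebraic extension of `α` over `S₀'` is FLAT for Gauss–Manin (Thm. 11.3.15 (1), a Baire
argument using absoluteness once more), i.e. a locally constant section of `R²ᵖ f'_* ℂ` through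
`α`, so every loop at `s` that lifts to a closed loop at `s'` acts trivially on `α`. This is the
hypothesis `hA` below, stated over the tree's carriers only (`IsAbsoluteHodgeClass`,
`IsContinuationAlong`, `Motives.AlgPoints.map`); everything after it is PROVED in the tree or is an
existing route item:

* the continuous global section upstairs (`exists_continuous_section_familyPullback`, Voisin II
  Lemma 4.17 with Ehresmann), a smooth projective compactification of `𝒳 ×_S S'` DEFINED OVER `ℚ̄`
  (`exists_smoothProjective_baseChangeHom_compactification_familyPullback_of_isQuasiProjectiveOver`:
  Hironaka over `ℚ̄`, proved), Deligne's global invariant cycle theorem = the route item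
  `LinearSystemTorelli.DeligneGlobalInvariantCycles` (stmt-HodgeConjecture-16363) with the proved
  Hodge lift (`deligne_globalInvariantCycles.exists_hodgeClass_eq_globalSection_of_exists_isReal_hodgeModel`,
  polarisability `smoothProjective_hodgeStructure_isPolarizable_holds`), a number-field model of
  the `ℚ̄`-compactification (`Theorems.stub_numberFieldModel`, proved), `HCOverNumberFields` (the
  crux's own antecedent), and pull-back of algebraic classes = the route item
  `BoundaryReadout.PullbackAlgebraic` (stmt-HodgeConjecture-1071).

So the crux hinges on ONE arithmetic hypothesis `hA` (theorem in print; its formalisation debt is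
algebraic de Rham cohomology over non-closed fields with the Gauss–Manin connection — the same
dictionary the registered stub S2 needs) and the two existing items 16363 and 1071.

## Main result

* `absoluteReduction_of_absoluteEtaleTrivialisation` — `hA` → D-item → P-item → `AbsoluteReduction`
  (CONDITIONAL: the gate records a `conditional-result`; the item stays open);
* `absoluteEtaleTrivialisation_of_typeStableOfAbsolute_of_riemannExistence` — the registered line's
  inputs S2 (type stability of absolute classes at `ℚ̄`-generic points) and C (Riemann existence with
  `ℚ̄`-descent, named fact `riemannExistence_qbarDescent_of_finiteIndex`) IMPLY `hA` (sorry-free):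
  the new road asks no more than the registered one, and strictly less (no C). (Composed with the
  main result it re-derives `absoluteReduction_of_typeStableOfAbsolute` of
  `Theorems/BoundaryReadoutAbsoluteReductionOfTypeStability.lean`, already landed — not restated.)

## References

* F. Charles, C. Schnell, *Notes on absolute Hodge classes*, in *Hodge Theory* (Math. Notes 49,
  2014), Thm. 11.3.15 (1), Cor. 11.3.16, Thm. 11.3.19 (= arXiv:1101.3647, Thm. 44 (1), Thm. 45,
  Thm. 50). [CharlesSchnell2014Notes]
* C. Voisin, *Hodge loci and absolute Hodge classes*, Compositio Math. 143 (2007), §3, proof of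
  Prop. 1.2 (arXiv math/0605766, pp. 6–7). [Voisin2007HodgeLoci]
* P. Deligne, *Théorie de Hodge II*, Publ. Math. IHÉS 40 (1971), Thm. 4.1.1. [DeligneHodgeII1971]
* H. Hironaka, Ann. of Math. 79 (1964), Main Theorem I. [Hironaka1964]
-/

-- every declaration of this problem lives in `Summit.HodgeConjecture.HodgeConjecture.…`
-- (single-problem summit: Problem = Summit), which `linter.dupNamespace` flags; set so that
-- stand-alone elaboration is warning-free.
set_option linter.dupNamespace false

noncomputable section

namespace Summit.HodgeConjecture.HodgeConjecture.Theorems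

open CategoryTheory CategoryTheory.Limits AlgebraicGeometry
open _root_.Topology
open Literature.AlgebraicGeometry Literature.AlgebraicGeometry.Motives
open Literature.AlgebraicGeometry.HodgeTheory
open Literature.AlgebraicTopology.SingularHomology
open Summit.HodgeConjecture.HodgeConjecture.Theses

/-- **The crux modulo an étale `ℚ̄`-neighbourhood trivialising the monodromy of an absolute class
(no Riemann existence, no type-stability detour).** Hypotheses: `hA` — for `σ : ℚ̄ →+* ℂ`, a
`ℚ̄`-morphism `f₀ : 𝒳₀ ⟶ S₀` of quasi-projective `ℚ̄`-schemes with `S₀` smooth irreducible and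
smooth projective complexification of relative dimension `n`, a complex point `s` over the GENERIC
point of `S₀` and an ABSOLUTE Hodge class `α` on `𝒳_s`, there are an étale `g₀ : S₀' ⟶ S₀` over
`ℚ̄` with `S₀'` quasi-projective and `S₀' ⊗_σ ℂ` irreducible and a complex point `s'` of `S₀'` over
`s` such that the flat continuation of `α` along every loop at `s` lifting to a closed loop at `s'`
is `α` itself (Charles–Schnell Cor. 11.3.16 + Thm. 11.3.15 (1): `α` is defined over a finite
extension of `ℚ̄(S₀)` and its algebraic extension over the corresponding étale `S₀'` is flat —
theorem in print); `hD` — Deligne's global invariant cycle theorem (route item stmt-16363); `hP` —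
pull-back preserves algebraic classes (route item stmt-1071). Proof: given `HCOverNumberFields`, `X`
smooth projective and an absolute class `c`, spread `X` out over `ℚ̄` at a `ℚ̄`-generic point,
`e : X ≅ 𝒳_s` (proved); `α = (e⁻¹)^* c` is absolute (`Theorems.stub_absoluteOfIso`); `hA` gives the
étale neighbourhood; on the base-changed family `f' : 𝒳 ×_S S' ⟶ S'` the transferred class extends
to a continuous global section of `R²ᵖ f'_* ℂ` (transport commutes with étale base change; Voisin II
Lemma 4.17); a smooth projective compactification `i : 𝒳 ×_S S' ↪ X̄₀ ⊗_σ ℂ` defined over `ℚ̄`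
exists (Hironaka, proved); `hD` with the proved Hodge lift gives a rational `(p,p)` class `β` on
`X̄₀ ⊗_σ ℂ` restricting to the transferred class; `X̄₀` has a number-field model
(`Theorems.stub_numberFieldModel`), so `HCOverNumberFields` makes `β` algebraic; `hP` pulls
algebraicity back along `X'_{s'} ⟶ X̄₀ ⊗ ℂ`, across `X'_{s'} ≅ 𝒳_s`, and along `e`.
[cite: CharlesSchnell2014Notes, Thm. 11.3.15 (1), Cor. 11.3.16 and Thm. 11.3.19]
[cite: Voisin2007HodgeLoci, §3, proof of Prop. 1.2] [cite: DeligneHodgeII1971, Théorème 4.1.1] -/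
theorem absoluteReduction_of_absoluteEtaleTrivialisation
    (hA : ∀ (σ : AlgebraicClosure ℚ →+* ℂ) ⦃𝒳₀ S₀ : SchemeOver (AlgebraicClosure ℚ)⦄ (f₀ : 𝒳₀ ⟶ S₀)
      (n p : ℕ), IsQuasiProjectiveOver 𝒳₀ → IsQuasiProjectiveOver S₀ → IrreducibleSpace S₀.left →
      AlgebraicGeometry.Smooth S₀.hom → IsSmoothProjectiveFamily ((baseChangeHom σ).map f₀) n →
      ∀ (s : ComplexPoints ((baseChangeHom σ).obj S₀)),
        closure {(baseChangeHomFst σ S₀).base s.pt} = (Set.univ : Set S₀.left) →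
        ∀ (α : complexBetti (fiberOver ((baseChangeHom σ).map f₀) s) (2 * p)),
          IsAbsoluteHodgeClass n (fiberOver ((baseChangeHom σ).map f₀) s) p α →
          ∃ (S₀' : SchemeOver (AlgebraicClosure ℚ)) (g₀ : S₀' ⟶ S₀)
            (s' : ComplexPoints ((baseChangeHom σ).obj S₀')),
            AlgPoints.map ((baseChangeHom σ).map g₀) s' = s ∧
            IsQuasiProjectiveOver S₀' ∧ IrreducibleSpace ((baseChangeHom σ).obj S₀').left ∧
            AlgebraicGeometry.Etale g₀.left ∧
            ∀ γ : Path s s,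
              (∃ γ' : Path s' s', ∀ u, AlgPoints.map ((baseChangeHom σ).map g₀) (γ' u) = γ u) →
              ∀ β : complexBetti (fiberOver ((baseChangeHom σ).map f₀) s) (2 * p),
                IsContinuationAlong γ α β → β = α)
    (hD : LinearSystemTorelli.DeligneGlobalInvariantCycles) (hP : BoundaryReadout.PullbackAlgebraic) :
    BoundaryReadout.AbsoluteReduction := by
  unfold BoundaryReadout.AbsoluteReduction
  intro hQ n X hX
  -- conjunct 1: a Hodge model exists (tree theorem); conjunct 2: absolute ⇒ algebraic
  refine ⟨nonempty_hodgeModel_holds hX, fun p c hc ↦ ?_⟩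
  -- an embedding `σ : ℚ̄ →+* ℂ`
  obtain ⟨σ⟩ := exists_ringHom_algebraicClosure_rat_complex
  -- spread `X` out over `ℚ̄`: `e : X ≅ 𝒳_s`, `s` over the generic point of the smooth irreducible `S₀`
  obtain ⟨𝒳₀, S₀, f₀, s, h𝒳₀, hS₀, hirr, hsm, hf, hgen, ⟨e⟩⟩ :=
    spreadingOut_smoothProjective_qbarFamily_holds σ hX
  -- S1 (landed): the transported class `α = (e⁻¹)^* c` is absolute Hodge on the fibre
  have habs : IsAbsoluteHodgeClass n (fiberOver ((baseChangeHom σ).map f₀) s) p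
      (complexBetti.map e.inv (2 * p) c) :=
    stub_absoluteOfIso e.symm hX (hf.isSmoothProjective s) p c hc
  -- the étale `ℚ̄`-neighbourhood trivialising the monodromy of `α` (hypothesis `hA`)
  obtain ⟨S₀', g₀, s', hs, hS₀'qp, hS'irr, hg₀, hfix⟩ :=
    hA σ f₀ n p h𝒳₀ hS₀ hirr hsm hf s hgen _ habs
  subst hs
  set α : complexBetti (fiberOver ((baseChangeHom σ).map f₀)
      (AlgPoints.map ((baseChangeHom σ).map g₀) s')) (2 * p) := complexBetti.map e.inv (2 * p) c
    with hα
  have hXs : IsSmoothProjective n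
      (fiberOver ((baseChangeHom σ).map f₀) (AlgPoints.map ((baseChangeHom σ).map g₀) s')) :=
    hf.isSmoothProjective _
  -- the bases `S = S₀ ⊗ ℂ`, `S' = S₀' ⊗ ℂ` are smooth of the same pure dimension `d`,
  -- quasi-projective; `S'(ℂ)` is a connected manifold; `g(ℂ)` is a local homeomorphism
  -- (bookkeeping as in `voisin2007_algebraic_of_finite_monodromyOrbit_of_qbar_of_classical_inputs`)
  haveI := hirr
  haveI := hsm
  obtain ⟨d, hd⟩ := Motives.exists_smoothOfRelativeDimension_of_smooth S₀.hom
  haveI := hd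
  haveI hSd : SmoothOfRelativeDimension d ((baseChangeHom σ).obj S₀).hom :=
    smoothOfRelativeDimension_baseChangeHom_hom σ d S₀
  have hSqp : IsQuasiProjectiveOver ((baseChangeHom σ).obj S₀) := hS₀.baseChangeHom σ
  have hS'qp : IsQuasiProjectiveOver ((baseChangeHom σ).obj S₀') := hS₀'qp.baseChangeHom σ
  haveI : LocallyOfFiniteType ((baseChangeHom σ).obj S₀).hom := hSqp.locallyOfFiniteType
  haveI : LocallyOfFiniteType ((baseChangeHom σ).obj S₀').hom := hS'qp.locallyOfFiniteType
  haveI : IsSeparated ((baseChangeHom σ).obj S₀).hom := hSqp.isVarietyPair_ofScheme.isSeparated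
  haveI := hg₀
  haveI hg0 : SmoothOfRelativeDimension 0 ((baseChangeHom σ).map g₀).left := by
    letI := σ.toAlgebra
    have := smoothOfRelativeDimension_isStableUnderBaseChange 0
    exact MorphismProperty.of_isPullback (P := @SmoothOfRelativeDimension 0)
      (Motives.isPullback_baseChange_map_left ℂ g₀).flip inferInstance
  haveI : AlgebraicGeometry.Smooth ((baseChangeHom σ).map g₀).left :=
    SmoothOfRelativeDimension.smooth 0 _
  haveI hS'd : SmoothOfRelativeDimension d ((baseChangeHom σ).obj S₀').hom := by
    have h : SmoothOfRelativeDimension (0 + d)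
        (((baseChangeHom σ).map g₀).left ≫ ((baseChangeHom σ).obj S₀).hom) :=
      inferInstance
    rw [Over.w] at h
    simpa using h
  haveI : IrreducibleSpace ((baseChangeHom σ).obj S₀').left := hS'irr
  haveI : ConnectedSpace (ComplexPoints ((baseChangeHom σ).obj S₀')) :=
    (Motives.ComplexPoints.connectedSpace_iff_holds _).2 inferInstance
  haveI : PathConnectedSpace (ComplexPoints ((baseChangeHom σ).obj S₀')) :=
    pathConnectedSpace_complexPoints_of_smoothOfRelativeDimension _ d
  letI := Motives.ComplexPoints.chartedSpace ((baseChangeHom σ).obj S₀') d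
  haveI : LocallyPathConnectedSpace (ComplexPoints ((baseChangeHom σ).obj S₀')) :=
    ChartedSpace.locallyPathConnectedSpace (EuclideanSpace ℝ (Fin (2 * d))) _
  have hgloc : IsLocalHomeomorph (AlgPoints.map ((baseChangeHom σ).map g₀) :
      ComplexPoints ((baseChangeHom σ).obj S₀') → ComplexPoints ((baseChangeHom σ).obj S₀)) :=
    Motives.ComplexPoints.isLocalHomeomorph_map d _
  -- the local systems `R²ᵖ f_* ℂ` on `S(ℂ)` and `R²ᵖ f'_* ℂ` on `S'(ℂ)` (Ehresmann, proved)
  have hU := isCohomologicallyLocallyTrivialOn_univ_of_isSmoothProjectiveFamily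
    ((baseChangeHom σ).map f₀) d hf hSqp
  have hf' := hf.familyPullback_snd ((baseChangeHom σ).map g₀)
  have hU' := isCohomologicallyLocallyTrivialOn_univ_of_isSmoothProjectiveFamily
    (familyPullback.snd ((baseChangeHom σ).map f₀) ((baseChangeHom σ).map g₀)) d hf' hS'qp
  -- the monodromy of `α` along the images of the loops at `s'` is trivial (hypothesis `hA`,
  -- read through "continuation along a path = transport", proved)
  have hinv : ∀ γ' : Path (⟨s', Set.mem_univ s'⟩ :
      (Set.univ : Set (ComplexPoints ((baseChangeHom σ).obj S₀')))) ⟨s', Set.mem_univ s'⟩,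
      transportFun ((baseChangeHom σ).map f₀) (2 * p) hU
        (s := ⟨AlgPoints.map ((baseChangeHom σ).map g₀) s', Set.mem_univ _⟩)
        (t := ⟨AlgPoints.map ((baseChangeHom σ).map g₀) s', Set.mem_univ _⟩)
        ⟦γ'.map ((((AlgPoints.continuous_map ((baseChangeHom σ).map g₀)).comp
          continuous_subtype_val)).subtype_mk fun _ ↦ Set.mem_univ _)⟧ α = α := by
    intro γ'
    -- the image loop downstairs, as a plain path; it lifts to the closed loop `γ'` upstairs
    set δ : Path (AlgPoints.map ((baseChangeHom σ).map g₀) s')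
        (AlgPoints.map ((baseChangeHom σ).map g₀) s') :=
      (γ'.map continuous_subtype_val).map (AlgPoints.continuous_map ((baseChangeHom σ).map g₀))
      with hδ
    have hpath : γ'.map ((((AlgPoints.continuous_map ((baseChangeHom σ).map g₀)).comp
          continuous_subtype_val)).subtype_mk fun _ ↦ Set.mem_univ _) =
        δ.map (continuous_id.subtype_mk fun x ↦ Set.mem_univ x) := by
      ext u
      rfl
    rw [hpath]
    refine hfix δ ⟨γ'.map continuous_subtype_val, fun u ↦ rfl⟩ _ ?_
    exact (isContinuationAlong_iff_transportFun_eq _ _ hU δ α _).2 rfl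
  -- base change of the family: the transferred class `α' = e_F^* α` extends to a continuous
  -- global section of `R²ᵖ f'_* ℂ` (transport commutes with étale base change; Voisin II Lemma 4.17)
  set eF := fiberOverFamilyPullbackIso ((baseChangeHom σ).map f₀) ((baseChangeHom σ).map g₀) s'
    with heF
  obtain ⟨σ', hσ'c, hσ'pt, hσ'₀⟩ := exists_continuous_section_familyPullback
    ((baseChangeHom σ).map f₀) ((baseChangeHom σ).map g₀) (2 * p) hgloc hU hU' s'
    (complexBetti.map eF.hom (2 * p) α) (FiberClass.cls_baseChange_map_hom _ _ _ s' α) hinv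
  have h₀ : σ' s' ∈ locusOfHodgeClasses
      (familyPullback.snd ((baseChangeHom σ).map f₀) ((baseChangeHom σ).map g₀)) n p := by
    rw [hσ'₀]
    exact ⟨habs.1.map _, habs.2.1.map_of_iso eF⟩
  -- a smooth projective compactification DEFINED OVER `ℚ̄` of `𝒳 ×_S S'` (Hironaka over `ℚ̄`, proved)
  obtain ⟨m, Xbar₀, i, hXbar₀, hi⟩ :=
    exists_smoothProjective_baseChangeHom_compactification_familyPullback_of_isQuasiProjectiveOver
      σ f₀ g₀ n h𝒳₀ hS₀ hS₀'qp hsm hg₀ hS'irr hf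
  haveI := hi
  have hXbar : IsSmoothProjective m ((baseChangeHom σ).obj Xbar₀) :=
    IsSmoothProjective.baseChangeHom_holds σ hXbar₀
  -- global invariant cycles (route item stmt-16363) + the proved Hodge lift: a rational `(p,p)`
  -- class `β` on `X̄₀ ⊗_σ ℂ` with `β|_{X'_{s'}} = α'`
  obtain ⟨β, hβr, hβh, hβσ⟩ :=
    (show deligne_globalInvariantCycles from hD).exists_hodgeClass_eq_globalSection_of_exists_isReal_hodgeModel
      exists_isReal_hodgeModel_holds hodgePQ_independent_of_hodgeModel_holds
      smoothProjective_hodgeStructure_isPolarizable_holds _ i hf' hS'qp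
      (SmoothOfRelativeDimension.smooth d _) hXbar hi hσ'c hσ'pt h₀
  have hα'eq : complexBetti.map eF.hom (2 * p) α =
      complexBetti.map (fiberι (familyPullback.snd ((baseChangeHom σ).map f₀)
        ((baseChangeHom σ).map g₀)) s' ≫ i) (2 * p) β := by
    have h1 := hσ'₀.symm.trans hβσ
    rw [(FiberClass.mk_eq_mk_iff _ _).1 h1, complexBetti.map_comp, ModuleCat.comp_apply]
  -- `X̄₀` is smooth projective over `ℚ̄`, so it has a number-field model (N, proved); HC over
  -- number fields makes `β` algebraic
  obtain ⟨K, hK, hKn, ι₀, W₁, ⟨e₁⟩⟩ := stub_numberFieldModel Xbar₀ hXbar₀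
  obtain ⟨e₂⟩ := Literature.Barriers.HodgeConjecture.nonempty_iso_baseChangeHom_baseChangeHom ι₀ σ W₁
  have hHC : HodgeConjectureFor m ((baseChangeHom σ).obj Xbar₀) :=
    hQ hXbar ⟨K, hK, hKn, σ.comp ι₀, W₁, ⟨(baseChangeHom σ).mapIso e₁ ≪≫ e₂⟩⟩
  have hβalg : β ∈ algebraicClasses ((baseChangeHom σ).obj Xbar₀) p := hHC.2 p β hβr hβh
  -- P (route item stmt-1071): pull back along `X'_{s'} ⟶ X̄₀ ⊗ ℂ`, across `X'_{s'} ≅ 𝒳_s`,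
  -- and along `e.hom`
  have hα'alg := hP (hf'.isSmoothProjective s') hXbar
    (fiberι (familyPullback.snd ((baseChangeHom σ).map f₀) ((baseChangeHom σ).map g₀)) s' ≫ i)
    p β hβalg
  rw [← hα'eq] at hα'alg
  have hαalg : α ∈ algebraicClasses
      (fiberOver ((baseChangeHom σ).map f₀) (AlgPoints.map ((baseChangeHom σ).map g₀) s')) p :=
    (mem_algebraicClasses_map_iff_of_iso eF).1 hα'alg
  have key := hP hX hXs e.hom p _ hαalg
  rwa [hα, e.complexBetti_map_hom_map_inv] at key

/-- **The registered line's inputs imply the étale-trivialisation hypothesis** (so the road above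
asks no more than `Cruxes/AbsoluteReduction/Lines/generic_flatness.lean`): from S2 (type stability
of the loop-continuations of an absolute class at a `ℚ̄`-generic point, Zariski-locally on the base)
and Riemann's existence theorem with `ℚ̄`-descent (named fact
`FundamentalGroup.riemannExistence_qbarDescent_of_finiteIndex`), the hypothesis `hA` of
`absoluteReduction_of_absoluteEtaleTrivialisation` follows: S2 with loop shrinking
(`IsContinuationAlong.exists_loop_forall_base_pt_notMem_of_qbarFamily`, proved) gives type stability
along every loop, hence a finite monodromy orbit (Hodge–Riemann + lattice finiteness,
`linearSystemTorelli_finite_setOf_isContinuationAlong_of_forall_isOfHodgeType`, proved), hence a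
finite-index stabiliser `H ≤ π₁(S(ℂ), s)` (`exists_finiteIndex_of_finite_setOf_isContinuationAlong_of_qbarFamily`,
proved); Riemann existence realises `H` by an étale `S₀' ⟶ S₀` over `ℚ̄` with a point `s'` over `s`
all of whose loops map into `H`; a loop at `s` lifting to a closed loop at `s'` is such an image, so
its transport fixes `α`, and continuation along a path is transport
(`isContinuationAlong_iff_transportFun_eq`, proved).
[cite: CharlesSchnell2014Notes, Thm. 11.3.15 (1) and Cor. 11.3.16]
[cite: SGA1, Exp. XII Thm. 5.1 and Exp. XIII Prop. 4.6] [cite: VoisinHodgeI2002, §9.2.1] -/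
theorem absoluteEtaleTrivialisation_of_typeStableOfAbsolute_of_riemannExistence
    (hT : ∀ (σ : AlgebraicClosure ℚ →+* ℂ) ⦃𝒳₀ S₀ : SchemeOver (AlgebraicClosure ℚ)⦄ (f₀ : 𝒳₀ ⟶ S₀)
      (n p : ℕ), IsQuasiProjectiveOver 𝒳₀ → IsQuasiProjectiveOver S₀ → IrreducibleSpace S₀.left →
      AlgebraicGeometry.Smooth S₀.hom → IsSmoothProjectiveFamily ((baseChangeHom σ).map f₀) n →
      ∀ (s : ComplexPoints ((baseChangeHom σ).obj S₀)),
        closure {(baseChangeHomFst σ S₀).base s.pt} = (Set.univ : Set S₀.left) →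
        ∀ (α : complexBetti (fiberOver ((baseChangeHom σ).map f₀) s) (2 * p)),
          IsAbsoluteHodgeClass n (fiberOver ((baseChangeHom σ).map f₀) s) p α →
          ∃ Z₀ : Set S₀.left, IsClosed Z₀ ∧ Z₀ ≠ Set.univ ∧
            ∀ (γ : Path s s), (∀ u, (baseChangeHomFst σ S₀).base (γ u).pt ∉ Z₀) →
              ∀ (β : complexBetti (fiberOver ((baseChangeHom σ).map f₀) s) (2 * p)),
                IsContinuationAlong γ α β →
                  IsOfHodgeType n (fiberOver ((baseChangeHom σ).map f₀) s) (2 * p) p p β)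
    (hC : Literature.AlgebraicGeometry.FundamentalGroup.riemannExistence_qbarDescent_of_finiteIndex) :
    ∀ (σ : AlgebraicClosure ℚ →+* ℂ) ⦃𝒳₀ S₀ : SchemeOver (AlgebraicClosure ℚ)⦄ (f₀ : 𝒳₀ ⟶ S₀)
      (n p : ℕ), IsQuasiProjectiveOver 𝒳₀ → IsQuasiProjectiveOver S₀ → IrreducibleSpace S₀.left →
      AlgebraicGeometry.Smooth S₀.hom → IsSmoothProjectiveFamily ((baseChangeHom σ).map f₀) n →
      ∀ (s : ComplexPoints ((baseChangeHom σ).obj S₀)),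
        closure {(baseChangeHomFst σ S₀).base s.pt} = (Set.univ : Set S₀.left) →
        ∀ (α : complexBetti (fiberOver ((baseChangeHom σ).map f₀) s) (2 * p)),
          IsAbsoluteHodgeClass n (fiberOver ((baseChangeHom σ).map f₀) s) p α →
          ∃ (S₀' : SchemeOver (AlgebraicClosure ℚ)) (g₀ : S₀' ⟶ S₀)
            (s' : ComplexPoints ((baseChangeHom σ).obj S₀')),
            AlgPoints.map ((baseChangeHom σ).map g₀) s' = s ∧
            IsQuasiProjectiveOver S₀' ∧ IrreducibleSpace ((baseChangeHom σ).obj S₀').left ∧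
            AlgebraicGeometry.Etale g₀.left ∧
            ∀ γ : Path s s,
              (∃ γ' : Path s' s', ∀ u, AlgPoints.map ((baseChangeHom σ).map g₀) (γ' u) = γ u) →
              ∀ β : complexBetti (fiberOver ((baseChangeHom σ).map f₀) s) (2 * p),
                IsContinuationAlong γ α β → β = α := by
  intro σ 𝒳₀ S₀ f₀ n p h𝒳₀ hS₀ hirr hsm hf s hgen α habs
  haveI := hirr
  haveI := hsm
  -- S2 + loop shrinking: type stability along every loop at `s`
  have hstab : ∀ (γ : Path s s) (β : complexBetti (fiberOver ((baseChangeHom σ).map f₀) s) (2 * p)),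
      IsContinuationAlong γ α β →
        IsOfHodgeType n (fiberOver ((baseChangeHom σ).map f₀) s) (2 * p) p p β := by
    intro γ β hγ
    obtain ⟨Z₀, hZ₀, hZ₀', H⟩ := hT σ f₀ n p h𝒳₀ hS₀ hirr hsm hf s hgen α habs
    obtain ⟨γ', hγ', hc'⟩ :=
      IsContinuationAlong.exists_loop_forall_base_pt_notMem_of_qbarFamily σ f₀ (2 * p) hS₀ hf hZ₀ hZ₀'
        hgen hγ
    exact H γ' hγ' β hc'
  -- finite monodromy orbit (Hodge–Riemann for the relative hyperplane class + lattice finiteness)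
  have hfin := linearSystemTorelli_finite_setOf_isContinuationAlong_of_forall_isOfHodgeType σ
    f₀ n p hf h𝒳₀ hS₀ hirr hsm s α habs.1 hstab
  -- a finite-index subgroup `H ≤ π₁(S(ℂ), s)` fixing `α` under transport
  obtain ⟨hU, H, hHfi, hHfix⟩ :=
    exists_finiteIndex_of_finite_setOf_isContinuationAlong_of_qbarFamily σ f₀ (2 * p) hS₀ hsm hf
      s α hfin
  -- Riemann existence with `ℚ̄`-descent: the étale `S₀' ⟶ S₀` realising `H`
  obtain ⟨S₀', g₀, s', hs, hS₀'qp, hS'irr, hg₀, -, hloops⟩ := hC σ S₀ hS₀ hirr hsm s H hHfi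
  refine ⟨S₀', g₀, s', hs, hS₀'qp, hS'irr, hg₀, ?_⟩
  subst hs
  rintro γ ⟨γ', hlift⟩ β hβ
  -- continuation along `γ` is transport along `⟦γ⟧`
  have h1 := (isContinuationAlong_iff_transportFun_eq _ _ hU γ α β).1 hβ
  -- the image of the closed loop `γ'` lies in `H`, hence fixes `α`
  have h2 : transportFun ((baseChangeHom σ).map f₀) (2 * p) hU
      (s := ⟨AlgPoints.map ((baseChangeHom σ).map g₀) s', Set.mem_univ _⟩)
      (t := ⟨AlgPoints.map ((baseChangeHom σ).map g₀) s', Set.mem_univ _⟩)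
      ⟦(γ'.map (continuous_id.subtype_mk fun x ↦ Set.mem_univ x)).map
        ((((AlgPoints.continuous_map ((baseChangeHom σ).map g₀)).comp
          continuous_subtype_val)).subtype_mk fun _ ↦ Set.mem_univ _)⟧ α = α :=
    hHfix _ (hloops (γ'.map (continuous_id.subtype_mk fun x ↦ Set.mem_univ x)))
  -- and that image is `γ`
  have hpath : (γ'.map (continuous_id.subtype_mk fun x ↦ Set.mem_univ x)).map
      ((((AlgPoints.continuous_map ((baseChangeHom σ).map g₀)).comp
        continuous_subtype_val)).subtype_mk fun _ ↦ Set.mem_univ _) =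
      γ.map (continuous_id.subtype_mk fun x ↦ Set.mem_univ x) :=
    Path.ext (funext fun u ↦ Subtype.ext (hlift u))
  rw [hpath] at h2
  exact h1.symm.trans h2

end Summit.HodgeConjecture.HodgeConjecture.Theorems

end
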